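import Mathlib
import Summits.CriticalPhenomena.PercolationContinuityZ3.Theorems.PercNearOneGluingNoHeavyLowerTailTNAllRays
import Summits.CriticalPhenomena.PercolationContinuityZ3.Theorems.PercNearOneGluingNoHeavyLowerTailOddsBernsteinX
import HarnessLib

/-!
# THEOREM X (discrete) for EVERY `θ > 0` and EVERY `γ > 0`: `x_m = γQ_θ(m)/((γ+m)P_θ(m)) = 1 − e_{m−1}/e_m` is completely monotone

Support file for the Sahi / Conjecture-P programme of route `PercNearOneGluingNoHeavy`
(`--supports stmt-CriticalPhenomena-4575`, prover prim-l12-p5 gen 42; proof note `prim-l12-p5/PROOF-TN-ALL-RAYS-g42.md` (2.1)).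
No definitions, no named facts, no sorries.

g36 (PROOF-THEOREM-H-g36 §6′) proved THEOREM X analytically for all `θ > 0`, `γ > 0`; the kernel had it only in Region I
(`pureGrabber_x_altSum_nonneg`, g37, `γ ≥ 1 − θ₀`, via CONJECTURE A′).  Here: `x = 1/(1+a) = g·ρ_{θ+1}/(1 − (1−g)ρ_{θ+1})`
(`hyp_level_raise` + c-contiguity `hyp_c_contig`), and `ρ_{θ+1} = Q_θ/Q_{θ+1}` is completely monotone for every `θ > 0`
(Region I g37, Region II = THEOREM RII g41), so LEMMA DB + Leibniz give:

* `pureGrabber_x_altSum_nonneg_of_ratio` — `ρ_{θ+1}` CM ⟹ `x` CM;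
* **`pureGrabber_x_altSum_nonneg_all`** — THEOREM X for every `θ = θ₀ + n > 0`, `γ > 0`, `0 < g < 1`.
-/

namespace Summit.CriticalPhenomena.PercolationContinuityZ3.Theorems

namespace HypergeomCM

open Finset MomentRatioTN
open scoped Nat

section

variable (g : ℝ) (H : ℝ → ℝ → ℕ → ℝ)
  (hH : ∀ a c r, H a c r = ∑ k ∈ range (r + 1), (r.choose k : ℝ) * (-g) ^ k *
    ((∏ i ∈ range k, (a + i)) / (∏ i ∈ range k, (c + i))))
include hH

/-- **THEOREM X from `ρ_{θ+1}`.**  If `ρ := Q_θ/Q_{θ+1}` is completely monotone then so is g36's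
`x_m = γQ_θ(m)/((γ+m)P_θ(m)) = 1/(1 + a_m)`: by `hyp_level_raise` and c-contiguity, `x = gρ/(1 − (1−g)ρ)` with `1 − (1−g)ρ`
positive with completely monotone first difference (LEMMA DB, Leibniz). -/
theorem pureGrabber_x_altSum_nonneg_of_ratio (hg0 : 0 < g) (hg1 : g < 1) (θ γ : ℝ) (hθ : 0 ≤ θ) (hγ : 0 < γ)
    (hu : ∀ k j, 0 ≤ ∑ i ∈ range (k + 1), (-1 : ℝ) ^ i * (k.choose i : ℝ) *
      (H (-θ) γ (j + i) * (H (-θ - 1) γ (j + i))⁻¹))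
    (k j : ℕ) :
    0 ≤ ∑ i ∈ range (k + 1), (-1 : ℝ) ^ i * (k.choose i : ℝ) *
      (γ * H (-θ) γ (j + i) / ((γ + ((j + i : ℕ) : ℝ)) * H (-θ) (γ + 1) (j + i))) := by
  have hQ : ∀ m, 0 < H (-θ) γ m := fun m => hyp_pos g H hH hg0.le hg1 (-θ) m γ hγ (by linarith)
  have hQ1 : ∀ m, 0 < H (-θ - 1) γ m := fun m => hyp_pos g H hH hg0.le hg1 (-θ - 1) m γ hγ (by linarith)
  have hP : ∀ m, 0 < H (-θ) (γ + 1) m := fun m => hyp_pos g H hH hg0.le hg1 (-θ) m (γ + 1) (by linarith) (by linarith)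
  set u : ℕ → ℝ := fun m => H (-θ) γ m * (H (-θ - 1) γ m)⁻¹ with hudef
  have hu0 : u 0 = 1 := by simp [hudef, hyp_zero g H hH]
  have hupos : ∀ m, 0 < u m := fun m => mul_pos (hQ m) (inv_pos.2 (hQ1 m))
  have hmono : ∀ m, u (m + 1) ≤ u m := by
    intro m
    have h := hu 1 m
    simp [sum_range_succ] at h
    simp only [hudef]
    linarith
  have hle1 : ∀ m, u m ≤ 1 := by
    intro m
    induction m with
    | zero => rw [hu0]
    | succ n ih => exact (hmono n).trans ih
  set f : ℕ → ℝ := fun m => 1 - (1 - g) * u m with hfdef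
  have hfpos : ∀ m, 0 < f m := by
    intro m
    simp only [hfdef]
    have := hle1 m
    nlinarith [hupos m]
  -- x = g u / f : from γQ_{θ+1}(m) = γQ_θ(m) + g m P_θ(m−1) (level raise) and γQ_θ(m) = (γ+m)P_θ(m) − mP_θ(m−1) (c-contiguity)
  have hx : ∀ m : ℕ, γ * H (-θ) γ m / ((γ + (m : ℝ)) * H (-θ) (γ + 1) m) = g * (u m * (f m)⁻¹) := by
    intro m
    have hlr := hyp_level_raise g H hH θ γ hθ hγ m
    have hcc : γ * H (-θ) γ m = (γ + (m : ℝ)) * H (-θ) (γ + 1) m - (m : ℝ) * H (-θ) (γ + 1) (m - 1) := by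
      rcases m with _ | r
      · simp [hyp_zero g H hH]
      · have hc := hyp_c_contig g H hH (-θ) γ hγ r
        rw [Nat.add_sub_cancel]
        push_cast
        linear_combination hc
    have hA := (hQ m).ne'
    have hB := (hP m).ne'
    have hC := (hQ1 m).ne'
    have hγ0 := hγ.ne'
    have hg0' := hg0.ne'
    have hm : (γ + (m : ℝ)) ≠ 0 := by positivity
    -- f m = g (γ+m) P(m) / (γ Q_{θ+1}(m))
    have hK : f m = g * (γ + (m : ℝ)) * H (-θ) (γ + 1) m / (γ * H (-θ - 1) γ m) := by
      simp only [hfdef, hudef]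
      rw [eq_div_iff (mul_ne_zero hγ0 hC)]
      field_simp
      linear_combination hlr + g * hcc
    have eR : u m * (f m)⁻¹ = γ * H (-θ) γ m / (g * (γ + (m : ℝ)) * H (-θ) (γ + 1) m) := by
      rw [hK]
      simp only [hudef]
      field_simp
    rw [eR]
    field_simp
  have hfinv : ∀ k j, 0 ≤ ∑ i ∈ range (k + 1), (-1 : ℝ) ^ i * (k.choose i : ℝ) * (f (j + i))⁻¹ := by
    refine altSum_inv_nonneg f hfpos fun k j => ?_
    have e : ∀ i : ℕ, f (j + i + 1) - f (j + i) = (1 - g) * (u (j + i) - u (j + i + 1)) := by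
      intro i; simp only [hfdef]; ring
    simp_rw [e]
    have hc := altSum_const_mul (1 - g) (fun n : ℕ => u n - u (n + 1)) k j
    beta_reduce at hc
    rw [hc, ← altSum_succ u k j]
    exact mul_nonneg (by linarith) (hu (k + 1) j)
  have e : ∀ i : ℕ, γ * H (-θ) γ (j + i) / ((γ + ((j + i : ℕ) : ℝ)) * H (-θ) (γ + 1) (j + i)) =
      g * (u (j + i) * (f (j + i))⁻¹) := fun i => by exact_mod_cast hx (j + i)
  simp_rw [e]
  have hc := altSum_const_mul g (fun n : ℕ => u n * (f n)⁻¹) k j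
  beta_reduce at hc
  rw [hc]
  exact mul_nonneg hg0.le (altSum_mul_nonneg u (fun m => (f m)⁻¹) hu hfinv k j)

/-- **THEOREM X (discrete) for EVERY `θ > 0`, EVERY `γ > 0`** (g36 §6′ proved it analytically; g37's `pureGrabber_x_altSum_nonneg` needed
`γ ≥ 1 − θ₀`): for `θ = θ₀ + n`, `0 < g < 1`, `x_m = γQ_θ(m)/((γ+m)P_θ(m)) = 1 − e_{m−1}/e_m` is completely monotone. -/
theorem pureGrabber_x_altSum_nonneg_all (hg0 : 0 < g) (hg1 : g < 1) (θ₀ : ℝ) (h0 : 0 < θ₀) (h1 : θ₀ ≤ 1) (n : ℕ)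
    (γ : ℝ) (hγ : 0 < γ) (k j : ℕ) :
    0 ≤ ∑ i ∈ range (k + 1), (-1 : ℝ) ^ i * (k.choose i : ℝ) *
      (γ * H (-(θ₀ + n)) γ (j + i) / ((γ + ((j + i : ℕ) : ℝ)) * H (-(θ₀ + n)) (γ + 1) (j + i))) := by
  have hθ : (0 : ℝ) ≤ θ₀ + n := by positivity
  have hu : ∀ k j, 0 ≤ ∑ i ∈ range (k + 1), (-1 : ℝ) ^ i * (k.choose i : ℝ) *
      (H (-(θ₀ + n)) γ (j + i) * (H (-(θ₀ + n) - 1) γ (j + i))⁻¹) := by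
    intro k j
    rcases le_or_gt (1 - θ₀) γ with hI | hII
    · have h := (hyp_inv_altSum_aux' g H hH hg0.le hg1 γ hγ θ₀ h0 h1 hI (n + 1)).2 k j
      have e1 : (1 : ℝ) - (θ₀ + ((n + 1 : ℕ) : ℝ)) = -(θ₀ + n) := by push_cast; ring
      have e2 : -(θ₀ + ((n + 1 : ℕ) : ℝ)) = -(θ₀ + n) - 1 := by push_cast; ring
      rw [e1, e2] at h
      exact h
    · have h := (hyp_inv_ratio_altSum_regionII g H hH hg0.le hg1 γ hγ θ₀ h0 (by linarith) n).2 k j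
      have e1 : (1 : ℝ) - (θ₀ + 1 + n) = -(θ₀ + n) := by ring
      have e2 : -(θ₀ + 1 + (n : ℝ)) = -(θ₀ + n) - 1 := by ring
      rw [e1, e2] at h
      exact h
  exact pureGrabber_x_altSum_nonneg_of_ratio g H hH hg0 hg1 (θ₀ + n) γ hθ hγ hu k j

end

end HypergeomCM

end Summit.CriticalPhenomena.PercolationContinuityZ3.Theorems
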